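import Mathlib

/-!
# Taylor jets at the origin for functions holomorphic on a disc (venture `DiscreteObjects`, target L)

Cell `pub-namedobj`, seat `pub-namedobj-mahler` (gen 8). Framing: lottery ticket; floor = certified
bounds/negative ranges.

Infrastructure for the in-tree proof of Smyth's theorem (`M(P) ≥ θ₀` for nonreciprocal `P ∈ ℤ[X]`,
[McKee–Smyth, *Around the Unit Circle*, Thm 12.1]): the proof manipulates finitely many Taylor
coefficients of bounded holomorphic functions on the unit disc.  We set up an elementary "jet calculus"
at `0` that avoids formal power series:

* `jetTail F n` — the `n`-th iterated divided difference `dslope · 0` of `F`; `jetCoeff F n = jetTail F n 0`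
  is the `n`-th Taylor coefficient;
* `jet_eq` — the EXACT Taylor formula `F z = Σ_{n<N} jetCoeff F n · zⁿ + z^N · jetTail F N z`, valid for
  every function and every `z` (pure algebra of `dslope`);
* `differentiableOn_jetTail` — tails of a function holomorphic on `ball 0 r` are holomorphic there
  (removable singularities, `Complex.differentiableOn_dslope`);
* `jetCoeff_unique` — uniqueness: an expansion `F z = Σ_{n<N} cₙ zⁿ + z^N ψ z` off `0` with `ψ` bounded
  near `0` forces `jetCoeff F n = cₙ` (`n < N`);
* linearity (`jetCoeff_add`, `jetCoeff_const_mul`, `jetCoeff_const`, …), the product rule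
  `jetCoeff_mul` (Cauchy product, via `Polynomial`), rotations `jetCoeff_comp_mul_left` and the
  rotation average `jetCoeff_rotAvg` (`k⁻¹ Σ_{j<k} F(ωʲ z)` keeps exactly the coefficients of index
  divisible by `k`), flat functions `eq_jetCoeff_zero_add_pow_mul`.
-/

namespace Summit.Ventures.DiscreteObjects.Mahler

open Polynomial Metric Filter Topology Asymptotics Finset

noncomputable section

/-! ### Definitions and the exact Taylor formula -/

/-- Iterated divided differences at `0`: `jetTail F 0 = F`, `jetTail F (n+1) = dslope (jetTail F n) 0`. -/
def jetTail (F : ℂ → ℂ) (n : ℕ) : ℂ → ℂ := (fun G : ℂ → ℂ => dslope G 0)^[n] F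

/-- The `n`-th Taylor coefficient of `F` at `0`. -/
def jetCoeff (F : ℂ → ℂ) (n : ℕ) : ℂ := jetTail F n 0

/-- `jetTail F 0 = F`. -/
theorem jetTail_zero (F : ℂ → ℂ) : jetTail F 0 = F := rfl

/-- `jetTail F (n+1) = dslope (jetTail F n) 0`. -/
theorem jetTail_succ (F : ℂ → ℂ) (n : ℕ) : jetTail F (n + 1) = dslope (jetTail F n) 0 := by
  rw [jetTail, Function.iterate_succ_apply']; rfl

/-- `jetTail F (n+1) = jetTail (dslope F 0) n`. -/
theorem jetTail_succ' (F : ℂ → ℂ) (n : ℕ) : jetTail F (n + 1) = jetTail (dslope F 0) n := by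
  rw [jetTail, Function.iterate_succ_apply]; rfl

/-- Tails compose additively in the index. -/
theorem jetTail_add (F : ℂ → ℂ) (m n : ℕ) : jetTail F (m + n) = jetTail (jetTail F m) n := by
  rw [jetTail, jetTail, jetTail, add_comm, Function.iterate_add_apply]

/-- The zeroth coefficient is the value at `0`. -/
theorem jetCoeff_zero (F : ℂ → ℂ) : jetCoeff F 0 = F 0 := rfl

/-- Coefficients of `F` are shifted coefficients of `dslope F 0`. -/
theorem jetCoeff_succ' (F : ℂ → ℂ) (n : ℕ) : jetCoeff F (n + 1) = jetCoeff (dslope F 0) n := by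
  rw [jetCoeff, jetTail_succ']; rfl

/-- `jetCoeff F (m+n)` is the `n`-th coefficient of the `m`-th tail. -/
theorem jetCoeff_add_index (F : ℂ → ℂ) (m n : ℕ) :
    jetCoeff F (m + n) = jetCoeff (jetTail F m) n := by
  rw [jetCoeff, jetCoeff, jetTail_add]

/-- Coefficients of a tail are shifted coefficients. -/
theorem jetCoeff_jetTail (F : ℂ → ℂ) (m n : ℕ) :
    jetCoeff (jetTail F m) n = jetCoeff F (m + n) := (jetCoeff_add_index F m n).symm

/-- The value of a tail at `0` is the corresponding coefficient. -/
theorem jetTail_apply_zero (F : ℂ → ℂ) (n : ℕ) : jetTail F n 0 = jetCoeff F n := rfl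

/-- One step of the Taylor formula: `jetTail F N z = jetCoeff F N + z · jetTail F (N+1) z`. -/
theorem jetTail_eq_coeff_add (F : ℂ → ℂ) (N : ℕ) (z : ℂ) :
    jetTail F N z = jetCoeff F N + z * jetTail F (N + 1) z := by
  have h := sub_smul_dslope (jetTail F N) 0 z
  rw [sub_zero, smul_eq_mul] at h
  rw [jetTail_succ, h, jetCoeff]; ring

/-- **Exact Taylor formula** (no hypotheses): `F z = Σ_{n<N} jetCoeff F n zⁿ + z^N jetTail F N z`. -/
theorem jet_eq (F : ℂ → ℂ) (N : ℕ) (z : ℂ) :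
    F z = (∑ n ∈ range N, jetCoeff F n * z ^ n) + z ^ N * jetTail F N z := by
  induction N with
  | zero => simp [jetTail_zero]
  | succ N ih => rw [ih, sum_range_succ, jetTail_eq_coeff_add F N z]; ring

/-- A flat function: if the coefficients of index `1, …, k-1` vanish then `F z = c₀ + z^k · jetTail F k z`. -/
theorem eq_jetCoeff_zero_add_pow_mul (F : ℂ → ℂ) {k : ℕ} (hk : 1 ≤ k)
    (hflat : ∀ n, 0 < n → n < k → jetCoeff F n = 0) (z : ℂ) :
    F z = jetCoeff F 0 + z ^ k * jetTail F k z := by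
  rw [jet_eq F k z]
  congr 1
  rw [Finset.sum_eq_single_of_mem 0 (Finset.mem_range.mpr (by omega))]
  · simp
  · intro n hn hn0
    rw [hflat n (Nat.pos_of_ne_zero hn0) (Finset.mem_range.mp hn), zero_mul]

/-! ### Holomorphy of the tails -/

/-- Tails of a function holomorphic on `ball 0 r` are holomorphic there. -/
theorem differentiableOn_jetTail {F : ℂ → ℂ} {r : ℝ} (hr : 0 < r)
    (hF : DifferentiableOn ℂ F (ball 0 r)) (n : ℕ) : DifferentiableOn ℂ (jetTail F n) (ball 0 r) := by
  induction n with
  | zero => exact hF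
  | succ n ih =>
    rw [jetTail_succ]
    exact (Complex.differentiableOn_dslope (ball_mem_nhds _ hr)).mpr ih

/-- Tails of a function holomorphic on `ball 0 r` are continuous at `0`. -/
theorem continuousAt_jetTail {F : ℂ → ℂ} {r : ℝ} (hr : 0 < r)
    (hF : DifferentiableOn ℂ F (ball 0 r)) (n : ℕ) : ContinuousAt (jetTail F n) 0 :=
  ((differentiableOn_jetTail hr hF n).differentiableAt (ball_mem_nhds _ hr)).continuousAt

/-- A function continuous at `0` is bounded on punctured neighbourhoods of `0`. -/
theorem isBigO_one_of_continuousAt {ψ : ℂ → ℂ} (h : ContinuousAt ψ 0) :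
    ψ =O[𝓝[≠] (0 : ℂ)] (fun _ => (1 : ℝ)) :=
  (h.tendsto.mono_left nhdsWithin_le_nhds).isBigO_one ℝ

/-- Tails of a function holomorphic on `ball 0 r` are bounded near `0`. -/
theorem isBigO_one_jetTail {F : ℂ → ℂ} {r : ℝ} (hr : 0 < r)
    (hF : DifferentiableOn ℂ F (ball 0 r)) (n : ℕ) :
    jetTail F n =O[𝓝[≠] (0 : ℂ)] (fun _ => (1 : ℝ)) :=
  isBigO_one_of_continuousAt (continuousAt_jetTail hr hF n)

/-! ### Uniqueness of Taylor coefficients -/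

/-- The constant term of an expansion `F z = c₀ + z · B z` (off `0`, `B` bounded near `0`) of a function
continuous at `0` is `F 0`. -/
theorem apply_zero_eq_of_expansion {F B : ℂ → ℂ} {c₀ : ℂ} (hF : ContinuousAt F 0)
    (hB : B =O[𝓝[≠] (0 : ℂ)] (fun _ => (1 : ℝ)))
    (h : ∀ᶠ z in 𝓝[≠] (0 : ℂ), F z = c₀ + z * B z) : F 0 = c₀ := by
  have h1 : Tendsto (fun z => F z - c₀) (𝓝[≠] (0 : ℂ)) (𝓝 (F 0 - c₀)) :=
    ((hF.tendsto.sub tendsto_const_nhds).mono_left nhdsWithin_le_nhds)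
  have hz : Tendsto (fun z : ℂ => z) (𝓝[≠] (0 : ℂ)) (𝓝 0) :=
    (continuous_id.tendsto 0).mono_left nhdsWithin_le_nhds
  have h2 : (fun z : ℂ => z * B z) =o[𝓝[≠] (0 : ℂ)] (fun _ => (1 : ℝ)) := by
    have hz' : (fun z : ℂ => z) =o[𝓝[≠] (0 : ℂ)] (fun _ => (1 : ℝ)) :=
      (isLittleO_one_iff ℝ).mpr hz
    simpa using hz'.mul_isBigO hB
  have h3 : Tendsto (fun z : ℂ => z * B z) (𝓝[≠] (0 : ℂ)) (𝓝 0) := (isLittleO_one_iff ℝ).mp h2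
  have h4 : Tendsto (fun z => F z - c₀) (𝓝[≠] (0 : ℂ)) (𝓝 0) := by
    refine h3.congr' ?_
    filter_upwards [h] with z hz
    rw [hz]; ring
  have := tendsto_nhds_unique h1 h4
  exact sub_eq_zero.mp this

/-- **Uniqueness of Taylor coefficients.** If `F` is holomorphic on `ball 0 r` and
`F z = Σ_{n<N} c n zⁿ + z^N ψ z` for `z ≠ 0` in the ball, with `ψ` bounded near `0`, then
`jetCoeff F n = c n` for all `n < N`. -/
theorem jetCoeff_unique {r : ℝ} (hr : 0 < r) {ψ : ℂ → ℂ}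
    (hψ : ψ =O[𝓝[≠] (0 : ℂ)] (fun _ => (1 : ℝ))) :
    ∀ (N : ℕ) (F : ℂ → ℂ) (c : ℕ → ℂ), DifferentiableOn ℂ F (ball 0 r) →
      (∀ z ∈ ball (0 : ℂ) r, z ≠ 0 → F z = (∑ n ∈ range N, c n * z ^ n) + z ^ N * ψ z) →
      ∀ n < N, jetCoeff F n = c n := by
  intro N
  induction N with
  | zero => intro F c _ _ n hn; omega
  | succ N ih =>
    intro F c hF h n hn
    have hball : ball (0 : ℂ) r ∈ 𝓝 (0 : ℂ) := ball_mem_nhds _ hr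
    have hmem : {(0 : ℂ)}ᶜ ∩ ball (0 : ℂ) r ∈ 𝓝[≠] (0 : ℂ) := inter_mem_nhdsWithin _ hball
    -- the expansion rewritten as `F z = c 0 + z * B z`
    set B : ℂ → ℂ := fun z => (∑ m ∈ range N, c (m + 1) * z ^ m) + z ^ N * ψ z with hB
    have hexp : ∀ z ∈ ball (0 : ℂ) r, z ≠ 0 → F z = c 0 + z * B z := by
      intro z hz hz0
      rw [h z hz hz0, hB]
      simp only
      rw [Finset.sum_range_succ', mul_add, Finset.mul_sum]
      have : ∀ m ∈ range N, z * (c (m + 1) * z ^ m) = c (m + 1) * z ^ (m + 1) := by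
        intro m _; ring
      rw [Finset.sum_congr rfl this]; ring
    have hBO : B =O[𝓝[≠] (0 : ℂ)] (fun _ => (1 : ℝ)) := by
      have hpoly : ContinuousAt (fun z : ℂ => ∑ m ∈ range N, c (m + 1) * z ^ m) 0 := by fun_prop
      have h1 := isBigO_one_of_continuousAt hpoly
      have hzN : ContinuousAt (fun z : ℂ => z ^ N) 0 := by fun_prop
      have h2 : (fun z : ℂ => z ^ N * ψ z) =O[𝓝[≠] (0 : ℂ)] (fun _ => (1 : ℝ)) := by
        simpa using (isBigO_one_of_continuousAt hzN).mul hψ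
      rw [hB]; exact h1.add h2
    have h0 : F 0 = c 0 := by
      apply apply_zero_eq_of_expansion (hF.differentiableAt hball).continuousAt hBO
      filter_upwards [hmem] with z hz
      exact hexp z hz.2 hz.1
    rcases n with _ | m
    · simpa [jetCoeff_zero] using h0
    · -- pass to `dslope F 0`
      have hdF : DifferentiableOn ℂ (dslope F 0) (ball 0 r) :=
        (Complex.differentiableOn_dslope hball).mpr hF
      have hexp' : ∀ z ∈ ball (0 : ℂ) r, z ≠ 0 →
          dslope F 0 z = (∑ m ∈ range N, c (m + 1) * z ^ m) + z ^ N * ψ z := by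
        intro z hz hz0
        rw [dslope_of_ne _ hz0, slope_def_field, sub_zero, h0, hexp z hz hz0]
        field_simp
        simp [hB]
      rw [jetCoeff_succ']
      exact ih (dslope F 0) (fun m => c (m + 1)) hdF hexp' m (by omega)

/-- Uniqueness, version with an expansion valid on the whole ball and `ψ` continuous at `0`. -/
theorem jetCoeff_unique' {r : ℝ} (hr : 0 < r) {F ψ : ℂ → ℂ} {N : ℕ} {c : ℕ → ℂ}
    (hF : DifferentiableOn ℂ F (ball 0 r)) (hψ : ContinuousAt ψ 0)
    (h : ∀ z ∈ ball (0 : ℂ) r, F z = (∑ n ∈ range N, c n * z ^ n) + z ^ N * ψ z) :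
    ∀ n < N, jetCoeff F n = c n :=
  jetCoeff_unique hr (isBigO_one_of_continuousAt hψ) N F c hF (fun z hz _ => h z hz)

/-! ### Linearity -/

/-- Additivity of Taylor coefficients. -/
theorem jetCoeff_add {r : ℝ} (hr : 0 < r) {F G : ℂ → ℂ} (hF : DifferentiableOn ℂ F (ball 0 r))
    (hG : DifferentiableOn ℂ G (ball 0 r)) (n : ℕ) :
    jetCoeff (fun z => F z + G z) n = jetCoeff F n + jetCoeff G n := by
  have hψ : ContinuousAt (fun z => jetTail F (n + 1) z + jetTail G (n + 1) z) 0 :=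
    (continuousAt_jetTail hr hF _).add (continuousAt_jetTail hr hG _)
  refine jetCoeff_unique' hr (F := fun z => F z + G z) (c := fun m => jetCoeff F m + jetCoeff G m)
    (hF.add hG) hψ ?_ n (Nat.lt_add_one n)
  intro z _
  rw [jet_eq F (n + 1) z, jet_eq G (n + 1) z]
  simp only [add_mul, Finset.sum_add_distrib]
  ring

/-- Homogeneity of Taylor coefficients. -/
theorem jetCoeff_const_mul {r : ℝ} (hr : 0 < r) {F : ℂ → ℂ} (hF : DifferentiableOn ℂ F (ball 0 r))
    (a : ℂ) (n : ℕ) : jetCoeff (fun z => a * F z) n = a * jetCoeff F n := by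
  have hψ : ContinuousAt (fun z => a * jetTail F (n + 1) z) 0 :=
    (continuousAt_const.mul (continuousAt_jetTail hr hF _))
  refine jetCoeff_unique' hr (F := fun z => a * F z) (c := fun m => a * jetCoeff F m)
    (hF.const_mul a) hψ ?_ n (Nat.lt_add_one n)
  intro z _
  rw [jet_eq F (n + 1) z, mul_add, Finset.mul_sum]
  have : ∀ m ∈ range (n + 1), a * (jetCoeff F m * z ^ m) = a * jetCoeff F m * z ^ m := by
    intro m _; ring
  rw [Finset.sum_congr rfl this]; ring

/-- Coefficients of `-F`. -/
theorem jetCoeff_neg {r : ℝ} (hr : 0 < r) {F : ℂ → ℂ} (hF : DifferentiableOn ℂ F (ball 0 r))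
    (n : ℕ) : jetCoeff (fun z => -F z) n = -jetCoeff F n := by
  have := jetCoeff_const_mul hr hF (-1) n
  simpa using this

/-- Coefficients of a difference. -/
theorem jetCoeff_sub {r : ℝ} (hr : 0 < r) {F G : ℂ → ℂ} (hF : DifferentiableOn ℂ F (ball 0 r))
    (hG : DifferentiableOn ℂ G (ball 0 r)) (n : ℕ) :
    jetCoeff (fun z => F z - G z) n = jetCoeff F n - jetCoeff G n := by
  have hψ : ContinuousAt (fun z => jetTail F (n + 1) z - jetTail G (n + 1) z) 0 :=
    (continuousAt_jetTail hr hF _).sub (continuousAt_jetTail hr hG _)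
  refine jetCoeff_unique' hr (F := fun z => F z - G z) (c := fun m => jetCoeff F m - jetCoeff G m)
    (hF.sub hG) hψ ?_ n (Nat.lt_add_one n)
  intro z _
  rw [jet_eq F (n + 1) z, jet_eq G (n + 1) z]
  simp only [sub_mul, Finset.sum_sub_distrib]
  ring

/-- Coefficients of a constant function. -/
theorem jetCoeff_const (a : ℂ) (n : ℕ) : jetCoeff (fun _ : ℂ => a) n = if n = 0 then a else 0 := by
  have hd : DifferentiableOn ℂ (fun _ : ℂ => a) (ball 0 1) := differentiableOn_const a
  have h := jetCoeff_unique' (N := n + 1) (c := fun m => if m = 0 then a else 0) one_pos hd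
    (ψ := fun _ => 0) continuousAt_const ?_ n (Nat.lt_add_one n)
  · exact h
  · intro z _
    rw [Finset.sum_eq_single_of_mem 0 (Finset.mem_range.mpr (by omega))]
    · simp
    · intro m _ hm; simp [hm]

/-- Coefficients of a monomial `a z^k`. -/
theorem jetCoeff_id_mul_pow (a : ℂ) (k n : ℕ) :
    jetCoeff (fun z : ℂ => a * z ^ k) n = if n = k then a else 0 := by
  have hd : DifferentiableOn ℂ (fun z : ℂ => a * z ^ k) (ball 0 1) := by fun_prop
  refine jetCoeff_unique' (N := max n k + 1) (c := fun m => if m = k then a else 0) one_pos hd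
    (ψ := fun _ => 0) continuousAt_const ?_ n (by omega)
  intro z _
  rw [Finset.sum_eq_single_of_mem k (Finset.mem_range.mpr (by omega))]
  · simp
  · intro m _ hm; simp [hm]

end

end Summit.Ventures.DiscreteObjects.Mahler
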